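import Summits.Schanuel.Schanuel.Theorems.RootDecomp1BFinitePinningFloor04
import Summits.Schanuel.Schanuel.Theorems.RootDecomp1KHyper19
import Summits.Schanuel.Schanuel.Theorems.RootDecomp1KKummerClosureCells
import Summits.Schanuel.Schanuel.Theorems.RootDecomp1EssentialInEclCore
import Summits.Schanuel.Schanuel.Theorems.RoyCriterionRankOne
import Literature.NumberTheory.Transcendental.ZilberFieldCCP

/-!
# RootDecomp1BStoreyOneAtlas — part 01: lens 4, generation 28 «STOREY-ONE ATLAS» — PORT NOTE (census-1 gen 14, 2026-08-31): port of HOME/decomp-schanuel-lens-4/g28/StoreyOneAtlas.lean (sha256 f91ffd056eed3e49ff03ec8585477326f96875eec6c4200528952a26b17b7d78, 655 l; critic VERDICT STATUS L1569 (iii) optional PORT GO LOW, census lane) in two parts `RootDecomp1BStoreyOneAtlas01`/`02` (cut at §3b); `set_option linter.dupNamespace false` dropped, `isAlgebraic_sqrt_three` / `schanuelRank_one'` / `algebraicIndependent_pi_cexpPi` (dedup twin of `RootDecomp1EEngineType.algebraicIndependent_pi_exp_pi`) made private; statements/proofs verbatim; `--supports stmt-Schanuel-24622`; rung 0. The lens's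 header follows.

# `RootDecomp1BStoreyOneAtlas` — the STOREY-ONE ATLAS of the crux `KleinPolarSchanuel` (lens 4, gen 28)

Owner certificate (decomp-schanuel lens 4, route-Schanuel-RootDecomp1B, X = `Theses.RootDecomp1B.KleinPolarSchanuel`,
stmt-Schanuel-24622).  STOREY ONE of X is the family of length-one Klein–polar cells
`X(1)(r) : trdeg_ℚ ℚ(r, ir, e^r, e^{ir}) ≥ 2` (`r ∈ ℝ^×`), typed in the tree as
`RootDecomp1BFinitePinningFloor.KleinPolarCellOne cexp r` (the `m = 1` layer of the live crux:
`kleinPolarCellOne_exp_of_kleinPolarSchanuel`).  This file records WHICH storey-one cells the tree ALREADY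
DECIDES for `exp`, by assembling engines that are not lens 4's:

* §1 dictionary `KleinPolarCellOne cexp r ↔ SB 2 ![r, ri]` (lens 6's `SB`);
* §2 the GENERATOR DROP: `k` algebraically independent numbers inside `ℚ(z, e^z, i, c)` give `SB N z` for
  `N + 1 ≤ k` (one auxiliary generator `c` costs at most one unit of transcendence degree);
* §2 also the FREE-AUXILIARY DROP (auxiliaries integral over `ℚ(z, e^z, i)` cost nothing);
* §3a DECIDED CELLS inside `A ⊕ Aπ`: (α) `r ∈ A^×` — HYPOTHESIS-FREE (Lindemann–Weierstrass, tree theorem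
  `algebraicIndependent_exp_holds`); (β₁) `r ∈ ℚ^×·π`, (β₃) `r ∈ ℚ^×·π√3` — mod the named facts `nesterenko`,
  `nesterenko'`, both PROVED in the tree (`nesterenko_holds`, `nesterenko'_holds`; binders only because that
  module is not built on the farm) + the free-auxiliary drop with `T = {a, e^{πa/n}}`; the other lines
  `ℚ^×·π√d` of `A ⊕ Aπ` are Nesterenko 1996 in print but have no tree statement, and the rest of `A ⊕ Aπ`
  is OPEN (GS+1 / N+1 at `e^π`, the floor's K-list);
* §3b DECIDED CELLS off `A ⊕ Aπ`:
  (HL) `r` hyper-Liouville — mod NW 1996 Thm 5(1) [lens 6, `sb_hyperLiouville_pair`];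
  (πHL) `r ∈ ℚ^×·π·HL` — HYPOTHESIS-FREE [lens 6, `algebraicIndependent_torsion` + §2], in particular the
  EXPLICIT real `π·λ_H` (`lambdaH`, lens 6's certified hyper-Liouville constant);
  (logHL) `r ∈ log a · HL` (`a > 0` real algebraic `≠ 1`) and (argHL) `r ∈ θ · HL` (`e^{iθ} ∈ ℚ̄ ∖ μ_∞`) —
  mod NW 1996 Thm 1 [lens 6, `algebraicIndependent_logCell` + §2];
* §4 CERTIFICATION `r ∉ A ⊕ Aπ` (`spanOnePi`) for (HL) and (πHL), hypothesis-free (torsion independence);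
* §5 the CO-COUNTABLE NORMAL FORM (Kirby 2010 Thm 1.2 / Prop 7.2, PROVED in the tree as piece K of
  route RootDecomp1, `essentialCounterexamplesInEcl_core`): `X(1)(r)` for every real `r ∉ ecl ∅`, hence the
  storey-one failure set is countable (`hasCountableClosureProperty_complex_holds`).

Honest label: COROLLARY / PLACEMENT — every engine is lens 6's (route 1K) or Literature (Lindemann–Weierstrass,
Nesterenko, Kirby, Hermite–Lindemann); lens 4 adds the dictionary, the two generator drops and the bookkeeping.
Facts enter as hypotheses only (`NesterenkoWaldschmidt1996_thm_5_1`, `NesterenkoWaldschmidt1996_thm_1`,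
`nesterenko`, `nesterenko'` — the last two proved in the tree); (α), (πHL), §4 and §5 are hypothesis-free.
No instance, no notation; sorry-free; standard axioms.  Nothing here proves Schanuel or the crux; rung 0.
-/

noncomputable section

open Complex IntermediateField Polynomial

namespace Summit.Schanuel.Schanuel.Theorems.RootDecomp1BStoreyOneAtlas

open Summit.Schanuel.Schanuel.Theorems.RootDecomp1BTranscendencePackageFloor (A Qb mem_Qb_iff mem_A_iff_coe_mem_Qb)
open Summit.Schanuel.Schanuel.Theorems.RootDecomp1BFinitePinningFloor (KleinPolarCellOne spanOnePi
  kleinPolarCellOne_exp_of_kleinPolarSchanuel)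
open Summit.Schanuel.Schanuel.Theorems.RootDecomp1BPeriodKernelFloor (algebraicIndependent_pi_expPi_complex)
open Summit.Schanuel.Schanuel.Theorems.RootDecomp1KHyper
open Summit.Schanuel.Schanuel.Theorems.RootDecomp1KHyper.HyperCell
open Summit.Schanuel.Schanuel.Theorems.RootDecomp1KRadical (FiniteTranscendenceType)
open Summit.Schanuel.Schanuel.Theorems.RootDecomp1KKummerClosure (algebraicIndependent_logCell
  finiteTranscendenceType_log)
open Literature.NumberTheory.Transcendental

/-! ## §0 Part-local tools (copies of private tree helpers) -/

/-- `trdeg_ℚ` is monotone along inclusions of subfields. [folklore] -/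
private theorem trdeg_mono {F E : Type*} [Field F] [Field E] [Algebra F E] {L L' : IntermediateField F E}
    (h : L ≤ L') : Algebra.trdeg F L ≤ Algebra.trdeg F L' :=
  trdeg_le_of_injective (IntermediateField.inclusion h) (IntermediateField.inclusion_injective h)

/-- A field generated by a set `S` has transcendence degree `≤ #S`. [folklore] -/
private theorem trdeg_adjoin_le_mk {F E : Type*} [Field F] [Field E] [Algebra F E] (S : Set E) :
    Algebra.trdeg F ↥(adjoin F S) ≤ Cardinal.mk S := by
  haveI := Literature.NumberTheory.Transcendental.isAlgebraic_adjoin_over_algebraAdjoin (F := F) S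
  exact (Algebra.IsAlgebraic.trdeg_le_cardinalMk F (((↑) : adjoin F S → E) ⁻¹' S)).trans
    (Cardinal.mk_preimage_of_injective _ _ Subtype.val_injective)

set_option synthInstance.maxHeartbeats 400000 in
/-- Subadditivity `trdeg_K K(S ∪ T) ≤ trdeg_K K(S) + trdeg_K K(T)`. [folklore] -/
private theorem trdeg_adjoin_union_le {K E : Type*} [Field K] [Field E] [Algebra K E] (S T : Set E) :
    Algebra.trdeg K ↥(adjoin K (S ∪ T)) ≤
      Algebra.trdeg K ↥(adjoin K S) + Algebra.trdeg K ↥(adjoin K T) := by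
  have htower := trdeg_add_eq K (adjoin K S) (A := adjoin (adjoin K S) T)
  have heq : Algebra.trdeg K (adjoin (adjoin K S) T) = Algebra.trdeg K (adjoin K (S ∪ T)) := by
    rw [← (equivOfEq (adjoin_adjoin_left K S T)).trdeg_eq]
    rfl
  have hbc := Literature.NumberTheory.Transcendental.trdeg_adjoin_le_of_le (K := K) (E := E)
    (F₁ := adjoin K (∅ : Set E)) (F₂ := adjoin K S) (adjoin.mono K _ _ (Set.empty_subset S)) T
  have htower0 := trdeg_add_eq K (adjoin K (∅ : Set E)) (A := adjoin (adjoin K (∅ : Set E)) T)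
  have heq0 : Algebra.trdeg K (adjoin (adjoin K (∅ : Set E)) T) = Algebra.trdeg K (adjoin K T) := by
    have h1 : Algebra.trdeg K ↥(adjoin K T) = Algebra.trdeg K ↥(adjoin K (∅ ∪ T)) := by
      rw [Set.empty_union]
    rw [h1, ← (equivOfEq (adjoin_adjoin_left K ∅ T)).trdeg_eq]
    rfl
  have hzero : Algebra.trdeg K ↥(adjoin K (∅ : Set E)) = 0 :=
    nonpos_iff_eq_zero.mp ((trdeg_adjoin_le_mk (F := K) (∅ : Set E)).trans (by simp))
  rw [hzero, zero_add, heq0] at htower0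
  rw [heq] at htower
  rw [← htower, ← htower0]
  gcongr

set_option synthInstance.maxHeartbeats 400000 in
/-- Adjoining an element INTEGRAL over `K(S)` is free: `trdeg_K K(S ∪ {c}) = trdeg_K K(S)`. [folklore] -/
private theorem trdeg_adjoin_integral_eq {K E : Type*} [Field K] [Field E] [Algebra K E] (S : Set E)
    {c : E} (hc : IsIntegral (adjoin K S) c) :
    Algebra.trdeg K ↥(adjoin K (S ∪ {c})) = Algebra.trdeg K ↥(adjoin K S) := by
  have htower := trdeg_add_eq K (adjoin K S) (A := adjoin (adjoin K S) ({c} : Set E))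
  have heq : Algebra.trdeg K (adjoin (adjoin K S) ({c} : Set E)) =
      Algebra.trdeg K (adjoin K (S ∪ {c})) := by
    rw [← (equivOfEq (adjoin_adjoin_left K S ({c} : Set E))).trdeg_eq]
    rfl
  rw [trdeg_adjoin_singleton_eq_zero hc, add_zero, heq] at htower
  exact htower.symm

/-- `trdeg` of `ℚ(S)` only depends on `S` (congruence, for re-associating generator sets). [folklore] -/
private theorem trdeg_adjoin_congr {S T : Set ℂ} (h : S = T) :
    Algebra.trdeg ℚ ↥(adjoin ℚ S) = Algebra.trdeg ℚ ↥(adjoin ℚ T) := by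
  subst h
  rfl

/-- An element of an intermediate field is integral over it. [folklore] -/
private theorem isIntegral_of_mem {L : IntermediateField ℚ ℂ} {y : ℂ} (hy : y ∈ L) : IsIntegral L y := by
  simpa using (isIntegral_algebraMap (R := ↥L) (A := ℂ) (x := (⟨y, hy⟩ : ↥L)))

/-- `k` algebraically independent numbers generate a field of transcendence degree `≥ k`. [folklore] -/
private theorem le_trdeg_adjoin_of_algebraicIndependent {ι : Type} [Fintype ι] {y : ι → ℂ}
    (h : AlgebraicIndependent ℚ y) :
    (Fintype.card ι : Cardinal) ≤ Algebra.trdeg ℚ ↥(adjoin ℚ (Set.range y)) := by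
  let f : ι → adjoin ℚ (Set.range y) := fun i => ⟨y i, subset_adjoin ℚ _ ⟨i, rfl⟩⟩
  have hf : AlgebraicIndependent ℚ f := AlgebraicIndependent.of_comp (adjoin ℚ (Set.range y)).val h
  simpa using hf.cardinalMk_le_trdeg

/-- `i` is algebraic (`i² + 1 = 0`). [folklore] -/
private theorem isAlgebraic_I' : IsAlgebraic ℚ Complex.I := by
  refine ⟨X ^ 2 + 1, ?_, ?_⟩
  · exact (Polynomial.monic_X_pow_add_C (1 : ℚ) two_ne_zero).ne_zero
  · simp [Complex.I_sq]

/-- Cardinal bookkeeping: `N + 1 ≤ t + 1 → N ≤ t` for a natural number `N`. [folklore] -/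
private theorem natCast_le_of_succ_le_add_one {N : ℕ} {t : Cardinal}
    (h : ((N + 1 : ℕ) : Cardinal) ≤ t + 1) : (N : Cardinal) ≤ t := by
  rcases lt_or_ge t Cardinal.aleph0 with ht | ht
  · obtain ⟨m, rfl⟩ := Cardinal.lt_aleph0.mp ht
    have h1 : ((N + 1 : ℕ) : Cardinal) ≤ ((m + 1 : ℕ) : Cardinal) := by push_cast at h ⊢; exact h
    have h2 : N + 1 ≤ m + 1 := by exact_mod_cast h1
    exact_mod_cast Nat.le_of_succ_le_succ h2
  · exact (Cardinal.natCast_lt_aleph0 (n := N)).le.trans ht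

/-! ## §1 The dictionary: the length-one Klein–polar cell of `exp` is `SB 2` of the polar pair -/

/-- The POLAR PAIR `(r, ir)` of a real `r`. [folklore] -/
abbrev polarPair (r : ℝ) : Fin 2 → ℂ := ![(r : ℂ), (r : ℂ) * I]

/-- The generators of `KleinPolarCellOne` at `m = 1` are the polar pair. [folklore] -/
theorem append_eq_polarPair (r : ℝ) :
    Fin.append (fun j => (((![r] : Fin 1 → ℝ) j : ℝ) : ℂ))
      (fun j => (((![r] : Fin 1 → ℝ) j : ℝ) : ℂ) * Complex.I) = polarPair r := by
  funext i
  refine Fin.addCases (fun j => ?_) (fun j => ?_) i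
  · rw [Fin.append_left]
    fin_cases j
    rfl
  · rw [Fin.append_right]
    fin_cases j
    rfl

/-- DICTIONARY: `X(1)(r)` for `exp` is `SB 2 (r, ir)`. [folklore] -/
theorem kleinPolarCellOne_exp_iff (r : ℝ) : KleinPolarCellOne cexp r ↔ SB 2 (polarPair r) := by
  unfold KleinPolarCellOne
  rw [← append_eq_polarPair]

/-- The polar pair of a non-zero real is `ℚ`-linearly independent. [folklore] -/
theorem linearIndependent_polarPair {r : ℝ} (hr : r ≠ 0) : LinearIndependent ℚ (polarPair r) := by
  rw [LinearIndependent.pair_iff]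
  intro s t h
  rw [Rat.smul_def, Rat.smul_def] at h
  have hre := congrArg Complex.re h
  have him := congrArg Complex.im h
  simp at hre him
  rcases hre with hre | hre
  · rcases him with him | him
    · exact ⟨hre, him⟩
    · exact absurd him hr
  · exact absurd hre hr

/-! ## §2 The generator drop -/

/-- **GENERATOR DROP.** `k` algebraically independent numbers inside `ℚ(z, e^z, i, c)` give `SB N z`
whenever `N + 1 ≤ k`: the auxiliary generator `c` raises the transcendence degree by at most one, and
`i` by nothing. [folklore] -/
theorem sb_of_algebraicIndependent_adjoin_one {ι : Type} [Fintype ι] {u : ι → ℂ}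
    (hai : AlgebraicIndependent ℚ u) {N : ℕ} {z : Fin N → ℂ} (c : ℂ) (hN : N + 1 ≤ Fintype.card ι)
    (hu : ∀ i, u i ∈ adjoin ℚ (SFset z ∪ {I} ∪ {c})) : SB N z := by
  have h2 := le_trdeg_adjoin_of_algebraicIndependent hai
  have hsub : Set.range u ⊆ (adjoin ℚ (SFset z ∪ {I} ∪ {c}) : Set ℂ) := by
    rintro x ⟨i, rfl⟩; exact hu i
  have hle : adjoin ℚ (Set.range u) ≤ adjoin ℚ (SFset z ∪ {I} ∪ {c}) := adjoin_le_iff.mpr hsub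
  have h3 := h2.trans (trdeg_mono hle)
  have h4 := trdeg_adjoin_union_le (K := ℚ) (SFset z ∪ {I}) ({c} : Set ℂ)
  have h5 := trdeg_adjoin_union_le (K := ℚ) (SFset z) ({I} : Set ℂ)
  rw [trdeg_adjoin_singleton_eq_zero isAlgebraic_I'.isIntegral, add_zero] at h5
  have hc : Algebra.trdeg ℚ ↥(adjoin ℚ ({c} : Set ℂ)) ≤ 1 :=
    (trdeg_adjoin_le_mk (F := ℚ) ({c} : Set ℂ)).trans (by simp)
  have h7 : ((N + 1 : ℕ) : Cardinal) ≤ (Fintype.card ι : Cardinal) := by exact_mod_cast hN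
  exact natCast_le_of_succ_le_add_one (h7.trans (h3.trans (h4.trans (add_le_add h5 hc))))

/-- Membership bookkeeping in `F = ℚ(z, e^z, i, c)`: the coordinates. [folklore] -/
theorem mem_F_coord {N : ℕ} (z : Fin N → ℂ) (c : ℂ) (j : Fin N) :
    z j ∈ adjoin ℚ (SFset z ∪ {I} ∪ {c}) :=
  subset_adjoin ℚ _ (Or.inl (Or.inl (Or.inl ⟨j, rfl⟩)))

/-- … the exponentials. [folklore] -/
theorem mem_F_exp {N : ℕ} (z : Fin N → ℂ) (c : ℂ) (j : Fin N) :
    cexp (z j) ∈ adjoin ℚ (SFset z ∪ {I} ∪ {c}) :=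
  subset_adjoin ℚ _ (Or.inl (Or.inl (Or.inr ⟨j, rfl⟩)))

/-- … `i`. [folklore] -/
theorem mem_F_I {N : ℕ} (z : Fin N → ℂ) (c : ℂ) : I ∈ adjoin ℚ (SFset z ∪ {I} ∪ {c}) :=
  subset_adjoin ℚ _ (Or.inl (Or.inr (Set.mem_singleton _)))

/-- … the auxiliary generator `c`. [folklore] -/
theorem mem_F_aux {N : ℕ} (z : Fin N → ℂ) (c : ℂ) : c ∈ adjoin ℚ (SFset z ∪ {I} ∪ {c}) :=
  subset_adjoin ℚ _ (Or.inr (Set.mem_singleton _))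

/-- **FREE-AUXILIARY DROP.** If the auxiliary set `T` does not raise the transcendence degree of
`ℚ(z, e^z, i)` (e.g. `T` consists of elements integral over it), `k` algebraically independent numbers
inside `ℚ(z, e^z, i, T)` give `SB N z` for `N ≤ k` — no unit is lost. [folklore] -/
theorem sb_of_algebraicIndependent_of_free {ι : Type} [Fintype ι] {u : ι → ℂ}
    (hai : AlgebraicIndependent ℚ u) {N : ℕ} {z : Fin N → ℂ} (T : Set ℂ)
    (hT : Algebra.trdeg ℚ ↥(adjoin ℚ (SFset z ∪ {I} ∪ T)) ≤ Algebra.trdeg ℚ ↥(adjoin ℚ (SFset z ∪ {I})))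
    (hN : N ≤ Fintype.card ι) (hu : ∀ i, u i ∈ adjoin ℚ (SFset z ∪ {I} ∪ T)) : SB N z := by
  have h2 := le_trdeg_adjoin_of_algebraicIndependent hai
  have hsub : Set.range u ⊆ (adjoin ℚ (SFset z ∪ {I} ∪ T) : Set ℂ) := by
    rintro x ⟨i, rfl⟩; exact hu i
  have h3 := (h2.trans (trdeg_mono (adjoin_le_iff.mpr hsub))).trans hT
  have h5 := trdeg_adjoin_union_le (K := ℚ) (SFset z) ({I} : Set ℂ)
  rw [trdeg_adjoin_singleton_eq_zero isAlgebraic_I'.isIntegral, add_zero] at h5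
  have h7 : ((N : ℕ) : Cardinal) ≤ (Fintype.card ι : Cardinal) := by exact_mod_cast hN
  exact h7.trans (h3.trans h5)

/-! ## §3a Decided storey-one cells INSIDE `A ⊕ Aπ` (LW and Nesterenko — both THEOREMS of the tree) -/

/-- **Cell (α)** `r ∈ A^×` (non-zero real algebraic): `X(1)(r)` by LINDEMANN–WEIERSTRASS
(`algebraicIndependent_exp_holds`, PROVED in the tree): `e^r, e^{ir}` are algebraically independent.
[cite: Weierstrass1885] -/
theorem kleinPolarCellOne_exp_of_isAlgebraic {r : ℝ} (hr : r ≠ 0) (ha : IsAlgebraic ℚ (r : ℂ)) :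
    KleinPolarCellOne cexp r := by
  have halg : ∀ i, IsAlgebraic ℚ (polarPair r i) := by
    intro i; fin_cases i
    · exact ha
    · exact ha.mul isAlgebraic_I'
  have hai : AlgebraicIndependent ℚ fun i => cexp (polarPair r i) :=
    algebraicIndependent_exp_holds (polarPair r) halg (linearIndependent_polarPair hr)
  refine (kleinPolarCellOne_exp_iff r).mpr (sb_of_algebraicIndependent hai (by simp) fun i => ?_)
  exact subset_adjoin ℚ _ (Or.inl (Or.inr ⟨i, rfl⟩))

/-- `√3 ∈ ℚ̄`. [folklore] -/
private theorem isAlgebraic_sqrt_three : IsAlgebraic ℚ ((Real.sqrt 3 : ℝ) : ℂ) := by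
  have hs2 : ((Real.sqrt 3 : ℝ) : ℂ) ^ 2 = (3 : ℂ) := by
    exact_mod_cast Real.sq_sqrt (by norm_num : (0 : ℝ) ≤ 3)
  refine ⟨X ^ 2 - C (3 : ℚ), ?_, ?_⟩
  · intro h0
    have := congr_arg (fun p : ℚ[X] => p.coeff 2) h0
    simp at this
  · simp [hs2]

/-- NESTERENKO at `τ = i`: `π, e^π` are algebraically independent — mod the named fact `nesterenko`, which is
PROVED in the tree (`Literature.NumberTheory.Transcendental.nesterenko_holds`, module `PeriodsWave0NesterenkoProofs`,
not built on the farm at writing time — hence the binder, 1B-floor port convention). [cite: NesterenkoPhilippon2001, Ch. 3 §1 Theorem 1.1 and Corollary 1.2 (p. 27, PDF p. 39)] -/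
private theorem algebraicIndependent_pi_cexpPi (hN : nesterenko) :
    AlgebraicIndependent ℚ ![(Real.pi : ℂ), cexp (Real.pi : ℂ)] :=
  algebraicIndependent_pi_expPi_complex hN

/-- NESTERENKO at `τ = ρ`: `π, e^{π√3}` are algebraically independent — mod the named fact `nesterenko'`,
PROVED in the tree (`nesterenko'_holds`, same module; binder for the same reason). [cite: NesterenkoPhilippon2001, Ch. 1 §3 Corollary 3.2 and Remark (ii) (PDF p. 19)] -/
theorem algebraicIndependent_pi_cexpPiSqrt3 (hN' : nesterenko') :
    AlgebraicIndependent ℚ ![(Real.pi : ℂ), cexp ((Real.pi : ℂ) * ((Real.sqrt 3 : ℝ) : ℂ))] := by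
  have hN : AlgebraicIndependent ℚ ![Real.pi, Real.exp (Real.pi * Real.sqrt 3), Real.Gamma (1 / 3)] :=
    hN'
  have h2 := hN.comp (Fin.castSucc : Fin 2 → Fin 3) (Fin.castSucc_injective _)
  have e2 : (![Real.pi, Real.exp (Real.pi * Real.sqrt 3), Real.Gamma (1 / 3)] ∘
      (Fin.castSucc : Fin 2 → Fin 3)) = ![Real.pi, Real.exp (Real.pi * Real.sqrt 3)] := by
    funext i; fin_cases i <;> simp
  rw [e2] at h2
  have h := h2.map' (f := (AlgHom.restrictScalars ℚ Complex.ofRealAm : ℝ →ₐ[ℚ] ℂ))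
    Complex.ofReal_injective
  have e : ((AlgHom.restrictScalars ℚ Complex.ofRealAm : ℝ →ₐ[ℚ] ℂ) : ℝ → ℂ) ∘
      ![Real.pi, Real.exp (Real.pi * Real.sqrt 3)] =
      ![(Real.pi : ℂ), cexp ((Real.pi : ℂ) * ((Real.sqrt 3 : ℝ) : ℂ))] := by
    funext i; fin_cases i <;> simp [Complex.ofReal_exp]
  rw [e] at h
  exact h

/-- The Nesterenko-line engine: for a non-zero real `a ∈ ℚ̄` with `π, e^{πa}` algebraically independent,
every `r ∈ ℚ^× · πa` satisfies `X(1)(r)` — FREE-AUXILIARY DROP with `T = {a, e^{πa/n}}` (`s = p/n`):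
`a ∈ ℚ̄` and `(e^{πa/n})^{|p|} = e^{±r}` are integral over `ℚ(r, ir, e^r, e^{ir}, i)`, and
`ℚ(…, a, e^{πa/n}) ∋ π = r/(sa), e^{πa} = (e^{πa/n})^n`. [folklore] -/
theorem kleinPolarCellOne_exp_of_rat_mul_pi_mul {a : ℝ} (ha : IsAlgebraic ℚ (a : ℂ)) (ha0 : a ≠ 0)
    (hai : AlgebraicIndependent ℚ ![(Real.pi : ℂ), cexp ((Real.pi : ℂ) * (a : ℂ))])
    {s : ℚ} (hs : s ≠ 0) : KleinPolarCellOne cexp ((s : ℝ) * Real.pi * a) := by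
  set r : ℝ := (s : ℝ) * Real.pi * a with hr
  have hπ0 : (Real.pi : ℂ) ≠ 0 := ofReal_ne_zero.mpr Real.pi_ne_zero
  have haC : (a : ℂ) ≠ 0 := ofReal_ne_zero.mpr ha0
  have hsC : (s : ℂ) ≠ 0 := by exact_mod_cast hs
  have hn0 : (s.den : ℂ) ≠ 0 := by exact_mod_cast s.den_nz
  have hp0 : s.num ≠ 0 := Rat.num_ne_zero.mpr hs
  -- the auxiliary `c = e^{πa/n}`
  set c : ℂ := cexp ((Real.pi : ℂ) * (a : ℂ) / (s.den : ℂ)) with hc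
  set S : Set ℂ := SFset (polarPair r) ∪ {I} with hS
  have hrS : (r : ℂ) ∈ adjoin ℚ S := subset_adjoin ℚ _ (Or.inl (Or.inl ⟨0, rfl⟩))
  have herS : cexp (r : ℂ) ∈ adjoin ℚ S := subset_adjoin ℚ _ (Or.inl (Or.inr ⟨0, rfl⟩))
  have hscast : (s : ℂ) = (s.num : ℂ) / (s.den : ℂ) := Rat.cast_def s
  -- `c^{|p|} = e^{±r} ∈ ℚ(S)`
  have hcpow : c ^ s.num.natAbs ∈ adjoin ℚ S := by
    have epow : c ^ s.num.natAbs = cexp ((s.num.natAbs : ℂ) * ((Real.pi : ℂ) * (a : ℂ) / (s.den : ℂ))) := by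
      rw [hc, ← Complex.exp_nat_mul]
    rcases Int.natAbs_eq s.num with h | h
    · have h1 : ((s.num : ℤ) : ℂ) = (((s.num.natAbs : ℕ) : ℤ) : ℂ) := congrArg (Int.cast : ℤ → ℂ) h
      rw [Int.cast_natCast] at h1
      have e : (s.num.natAbs : ℂ) * ((Real.pi : ℂ) * (a : ℂ) / (s.den : ℂ)) = (r : ℂ) := by
        rw [← h1, hr]; push_cast; rw [hscast]; field_simp
      rw [epow, e]; exact herS
    · have h1 : ((s.num : ℤ) : ℂ) = ((-((s.num.natAbs : ℕ) : ℤ) : ℤ) : ℂ) := congrArg (Int.cast : ℤ → ℂ) h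
      rw [Int.cast_neg, Int.cast_natCast] at h1
      have hcast : ((s.num.natAbs : ℕ) : ℂ) = -(s.num : ℂ) := by rw [h1, neg_neg]
      have e : (s.num.natAbs : ℂ) * ((Real.pi : ℂ) * (a : ℂ) / (s.den : ℂ)) = -(r : ℂ) := by
        rw [hcast, hr]; push_cast; rw [hscast]; field_simp
      rw [epow, e, Complex.exp_neg]; exact inv_mem herS
  -- free-ness of `T = {a} ∪ {c}`
  have haInt : IsIntegral (adjoin ℚ S) (a : ℂ) := ha.isIntegral.tower_top
  have hcInt : IsIntegral (adjoin ℚ (S ∪ {(a : ℂ)})) c := by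
    refine IsIntegral.of_pow (Int.natAbs_pos.mpr hp0) (isIntegral_of_mem ?_)
    exact adjoin.mono ℚ _ _ Set.subset_union_left hcpow
  have hT : Algebra.trdeg ℚ ↥(adjoin ℚ (S ∪ ({(a : ℂ)} ∪ {c}))) ≤ Algebra.trdeg ℚ ↥(adjoin ℚ S) := by
    have e1 := trdeg_adjoin_integral_eq (K := ℚ) S haInt
    have e2 := trdeg_adjoin_integral_eq (K := ℚ) (S ∪ {(a : ℂ)}) hcInt
    have e3 := trdeg_adjoin_congr (Set.union_assoc S {(a : ℂ)} {c}).symm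
    exact (e3.trans (e2.trans e1)).le
  -- memberships in `F = ℚ(S, a, c)`
  have hF_sub : (adjoin ℚ S : Set ℂ) ⊆ adjoin ℚ (S ∪ ({(a : ℂ)} ∪ {c})) :=
    adjoin.mono ℚ _ _ Set.subset_union_left
  have haF : (a : ℂ) ∈ adjoin ℚ (S ∪ ({(a : ℂ)} ∪ {c})) :=
    subset_adjoin ℚ _ (Or.inr (Or.inl (Set.mem_singleton _)))
  have hcF : c ∈ adjoin ℚ (S ∪ ({(a : ℂ)} ∪ {c})) :=
    subset_adjoin ℚ _ (Or.inr (Or.inr (Set.mem_singleton _)))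
  refine (kleinPolarCellOne_exp_iff r).mpr
    (sb_of_algebraicIndependent_of_free hai ({(a : ℂ)} ∪ {c}) hT (by simp) fun j => ?_)
  fin_cases j
  · -- `π = r / (s a)`
    have e : (Real.pi : ℂ) = (r : ℂ) / ((s : ℂ) * (a : ℂ)) := by
      rw [eq_div_iff (mul_ne_zero hsC haC), hr]; push_cast; ring
    show (Real.pi : ℂ) ∈ _
    rw [e]
    exact div_mem (hF_sub hrS) (mul_mem (SubfieldClass.ratCast_mem _ s) haF)
  · -- `e^{πa} = c^n`
    have e : cexp ((Real.pi : ℂ) * (a : ℂ)) = c ^ s.den := by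
      rw [hc, ← Complex.exp_nat_mul, mul_div_cancel₀ _ hn0]
    show cexp ((Real.pi : ℂ) * (a : ℂ)) ∈ _
    rw [e]
    exact pow_mem hcF _

/-- **Cell (β₁)** `r ∈ ℚ^×·π`: `X(1)(sπ)`, i.e. `trdeg ℚ(sπ, e^{sπ}, e^{isπ}) ≥ 2` — mod `nesterenko` (PROVED in the
tree: `nesterenko_holds`). [cite: NesterenkoPhilippon2001, Ch. 3 §1 Theorem 1.1 and Corollary 1.2 (p. 27, PDF p. 39)] -/
theorem kleinPolarCellOne_exp_of_rat_mul_pi (hN : nesterenko) {s : ℚ} (hs : s ≠ 0) :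
    KleinPolarCellOne cexp ((s : ℝ) * Real.pi) := by
  have hai : AlgebraicIndependent ℚ ![(Real.pi : ℂ), cexp ((Real.pi : ℂ) * ((1 : ℝ) : ℂ))] := by
    simpa using algebraicIndependent_pi_cexpPi hN
  have h1 : IsAlgebraic ℚ (((1 : ℝ) : ℂ)) := by simpa using isAlgebraic_one (R := ℚ) (A := ℂ)
  simpa using kleinPolarCellOne_exp_of_rat_mul_pi_mul h1 one_ne_zero hai hs

/-- In particular the cell at `π` itself (`s = 1`): `trdeg ℚ(π, e^π, e^{iπ}) ≥ 2` (cf. the floor's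
`kleinPolar_pi_cell_of`). [folklore] -/
theorem kleinPolarCellOne_exp_pi (hN : nesterenko) : KleinPolarCellOne cexp Real.pi := by
  simpa using kleinPolarCellOne_exp_of_rat_mul_pi hN (one_ne_zero)

/-- **Cell (β₃)** `r ∈ ℚ^×·π√3`: `X(1)(sπ√3)` — mod `nesterenko'` (PROVED in the tree:
`nesterenko'_holds`).
[cite: NesterenkoPhilippon2001, Ch. 1 §3 Corollary 3.2 and Remark (ii) (PDF p. 19)] -/
theorem kleinPolarCellOne_exp_of_rat_mul_pi_sqrt3 (hN' : nesterenko') {s : ℚ} (hs : s ≠ 0) :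
    KleinPolarCellOne cexp ((s : ℝ) * Real.pi * Real.sqrt 3) :=
  kleinPolarCellOne_exp_of_rat_mul_pi_mul isAlgebraic_sqrt_three
    (Real.sqrt_ne_zero'.mpr (by norm_num)) (algebraicIndependent_pi_cexpPiSqrt3 hN') hs

end Summit.Schanuel.Schanuel.Theorems.RootDecomp1BStoreyOneAtlas
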